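import Mathlib
import HarnessLib
import Summits.Ventures.LatticeQCDFlow.Exactness.NCMCGeneralSpaceEventTauIntPositive
import Summits.Ventures.LatticeQCDFlow.Exactness.NCMCGeneralSpaceDiagnosticsConsistency
import Summits.Ventures.LatticeQCDFlow.Scoring.ReversibleKernelTauIntFloor

/-!
# REVERSIBLE kernels: a Doeblin power gives an EXPLICIT `τ_int` floor for every bounded observable — `ρ(1) ≥ −r` and `τ_int ≥ (1 − r)/(2 (1 + r))` whenever `1 − e/2 ≤ r^{2^{J+1}}`, `m ≤ 2^{J+1}` (Poincaré inequality for the minorised power + Cauchy–Schwarz doubling + Madras–Slade)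

HONEST FRAMING: exact (Metropolis-corrected) sampling algorithms for lattice gauge theory;
figures of merit are autocorrelation/cost numbers at stated couplings and volumes; no
continuum-physics claim.

Venture `LatticeQCDFlow` (cell pub-lqcd), topic `Exactness`; FANOUT row 13 (`eng-snf`, GEN-21).
NEW WORK of the cell, not a published result; no definition is introduced; nothing is cited as a
fact (Madras–Slade 1993 Prop. 9.2.2 enters only through row 8's tree theorem
`Scoring.tauInt_ge_of_isReversible`).  Companion of GEN-21's `NCMCGeneralSpaceEventTauIntPositive`
(events, any kernel, qualitative) and `NCMCGeneralSpaceAsymptoticVarianceCounterexample` (a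
NON-reversible Doeblin square with `σ²_f = 0`): for a `π`-REVERSIBLE kernel a Doeblin power
`κ^m(x, ·) ≥ ε ν` bounds the lag-one autocorrelation of EVERY bounded observable away from `−1`,
with a constant.  Three elementary steps, no spectral theorem:
(1) POINCARÉ FOR A MINORISED KERNEL: if `P(x, ·) ≥ ε ν` and `π P = π` then for centred `g`,
`⟨g, P g⟩_π ≤ (1 − e/2) ‖g‖²` (`e = ε.toReal`; the Dirichlet form
`½ ∫∫ (g(x) − g(y))² P(x, dy) π(dx) = ‖g‖² − ⟨g, Pg⟩` is at least `½ e (‖g‖² + ν(g²))`);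
(2) CAUCHY–SCHWARZ DOUBLING for a reversible `κ` (`C(t) = ⟨g, κᵗ g⟩_π`, `C(2n) = ‖κⁿ g‖²`):
`C(n)² ≤ C(0) C(2n)`, hence `C(2)^{2^J} C(0) ≤ C(0)^{2^J} C(2^{J+1})`; with (1) for `P = κ^{2^{J+1}}`
(minorised as soon as `m ≤ 2^{J+1}`): `C(2) ≤ r² C(0)` and `|C(1)| ≤ r C(0)` for every `r > 0` with
`1 − e/2 ≤ r^{2^{J+1}}`;
(3) MADRAS–SLADE (row 8): `τ_int ≥ (1 + ρ(1))/(2(1 − ρ(1))) ≥ (1 − r)/(2(1 + r)) > 0`.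

## Content (`κ` Markov and `π`-reversible, `π` a probability law; `ε • ν ≤ (nHit κ m)(x, ·)`)

* `integral_mul_kop_le_of_minorised` — the Poincaré inequality (1) for any invariant Markov `P`
  with `ε • ν ≤ P(x, ·)`.
* `minorised_nHit_add` — `ε • ν ≤ (nHit κ (m + k))(x, ·)`.
* `autocov_eq_integral_mul_kop_nHit` — `C(t) = ∫ g · kop (nHit κ t) g dπ`.
* `autocov_sq_le_of_isReversible` — `C(n)² ≤ C(0) C(2n)`; `autocov_two_pow_le_of_isReversible` —
  `C(2)^{2^J} C(0) ≤ C(0)^{2^J} C(2^{J+1})`.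
* **`autocov_one_abs_le_of_isReversible_of_nHit`** — `|C(1)| ≤ r C(0)` (`1 − e/2 ≤ r^{2^{J+1}}`,
  `m ≤ 2^{J+1}`, `0 < r`, `C(0) > 0`).
* **`tauInt_ge_of_isReversible_of_nHit`** (`0 < r < 1`) — for every bounded measurable `f` with `Var_π f > 0`:
  `(1 − r)/(2(1 + r)) ≤ Scoring.tauInt (t ↦ C_f̄(t)/C_f̄(0))`; **`tauInt_setACF_ge_of_isReversible_of_nHit`**
  — the same for `setACF κ π A` of every event with `0 < π(A) < 1`.

NOT CLAIMED: non-reversible kernels (false in general — see the counterexample file; events are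
covered qualitatively by `tauInt_setACF_pos_of_nHit`); optimality of `r`; unbounded observables.
-/

namespace Summit.Ventures.LatticeQCDFlow.Exactness.GeneralNCMC

open MeasureTheory ProbabilityTheory Set Filter Finset
open scoped ENNReal NNReal Topology

variable {S : Type*} [MeasurableSpace S]

/-! ## §1 Poincaré inequality for a minorised kernel -/

section Poincare

variable {P : Kernel S S} [IsMarkovKernel P] {π : Measure S} [IsProbabilityMeasure π]
  {ν : Measure S} [IsProbabilityMeasure ν] {ε : ℝ≥0∞}

/-- **POINCARÉ INEQUALITY FOR A MINORISED KERNEL.**  `P` Markov, `π` invariant, `ε • ν ≤ P(x, ·)`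
for all `x`; `g` bounded measurable with `∫ g dπ = 0`.  Then
`∫ g · kop P g dπ ≤ (1 − ε.toReal/2) ∫ g² dπ`. -/
theorem integral_mul_kop_le_of_minorised (hπ : Kernel.Invariant P π) (hmin : ∀ z, ε • ν ≤ P z)
    {g : S → ℝ} (hg : Measurable g) {Cg : ℝ} (hCg : ∀ x, |g x| ≤ Cg) (hg0 : ∫ x, g x ∂π = 0) :
    ∫ x, g x * Scoring.kop P g x ∂π ≤ (1 - ε.toReal / 2) * ∫ x, g x ^ 2 ∂π := by
  haveI : Nonempty S := nonempty_of_isProbabilityMeasure π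
  have hCg0 : 0 ≤ Cg := (abs_nonneg _).trans (hCg (Classical.choice ‹Nonempty S›))
  obtain ⟨hKm, hKb⟩ := Scoring.iterate_kop_bounded_measurable P hg hCg 1
  simp only [Function.iterate_one] at hKm hKb
  have hg2m : Measurable fun y => g y ^ 2 := hg.pow_const 2
  have hg2b : ∀ y, |g y ^ 2| ≤ Cg ^ 2 := fun y => by
    rw [abs_pow]; exact pow_le_pow_left₀ (abs_nonneg _) (hCg y) 2
  -- pointwise: `∫ (g y − g x)² dP(x) = P(g²)(x) − 2 g(x) Pg(x) + g(x)²`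
  have hup : ∀ x, Scoring.kop P (fun y => (g y - g x) ^ 2) x
      = Scoring.kop P (fun y => g y ^ 2) x - 2 * (g x * Scoring.kop P g x) + g x ^ 2 := by
    intro x
    rw [kop_sqDev_eq P hg hCg (g x) x]
    ring
  -- pointwise: `∫ (g y − g x)² dP(x) ≥ e (ν(g²) − 2 g(x) ν(g) + g(x)²)`
  have hlow : ∀ x, ε.toReal * (∫ y, g y ^ 2 ∂ν - 2 * (g x * ∫ y, g y ∂ν) + g x ^ 2)
      ≤ Scoring.kop P (fun y => (g y - g x) ^ 2) x := by
    intro x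
    have hdm : Measurable fun y => (g y - g x) ^ 2 := (hg.sub_const _).pow_const 2
    have hdb : ∀ y, |(g y - g x) ^ 2| ≤ (Cg + Cg) ^ 2 := fun y => by
      rw [abs_pow]
      exact pow_le_pow_left₀ (abs_nonneg _) ((abs_sub _ _).trans (add_le_add (hCg y) (hCg x))) 2
    have hmono : ∫ y, (g y - g x) ^ 2 ∂(ε • ν) ≤ ∫ y, (g y - g x) ^ 2 ∂(P x) :=
      integral_mono_measure (hmin x) (ae_of_all _ fun y => sq_nonneg _)
        (Scoring.integrable_of_bounded _ hdm hdb)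
    rw [integral_smul_measure, smul_eq_mul] at hmono
    have hexp : ∫ y, (g y - g x) ^ 2 ∂ν = ∫ y, g y ^ 2 ∂ν - 2 * (g x * ∫ y, g y ∂ν) + g x ^ 2 := by
      have hi1 : Integrable (fun y => g y ^ 2) ν := Scoring.integrable_of_bounded ν hg2m hg2b
      have hi2 : Integrable (fun y => 2 * g x * g y) ν :=
        (Scoring.integrable_of_bounded ν hg hCg).const_mul _
      have hi3 : Integrable (fun y => g y ^ 2 - 2 * g x * g y) ν := hi1.sub hi2
      have he : (fun y => (g y - g x) ^ 2) = fun y => g y ^ 2 - 2 * g x * g y + g x ^ 2 := by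
        funext y; ring
      rw [he, integral_add hi3 (integrable_const _), integral_sub hi1 hi2, integral_const_mul,
        integral_const, probReal_univ, one_smul]
      ring
    rw [hexp] at hmono
    exact hmono
  -- integrate over `π`
  have hiL : Integrable (fun x => ε.toReal * (∫ y, g y ^ 2 ∂ν - 2 * (g x * ∫ y, g y ∂ν) + g x ^ 2)) π :=
    ((integrable_const _).sub (((Scoring.integrable_of_bounded π hg hCg).mul_const _).const_mul _)
      |>.add (Scoring.integrable_of_bounded π hg2m hg2b)).const_mul _
  have hprod_m : Measurable fun x => g x * Scoring.kop P g x := hg.mul hKm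
  have hprod_b : ∀ x, |g x * Scoring.kop P g x| ≤ Cg * Cg := fun x => by
    rw [abs_mul]; exact mul_le_mul (hCg x) (hKb x) (abs_nonneg _) hCg0
  have hiprod : Integrable (fun x => g x * Scoring.kop P g x) π :=
    Scoring.integrable_of_bounded π hprod_m hprod_b
  have hiK2 : Integrable (fun x => Scoring.kop P (fun y => g y ^ 2) x) π :=
    Scoring.integrable_of_bounded π (Scoring.measurable_kop P hg2m) (Scoring.abs_kop_le P hg2b)
  have hiU : Integrable (fun x => Scoring.kop P (fun y => g y ^ 2) x - 2 * (g x * Scoring.kop P g x)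
      + g x ^ 2) π := (hiK2.sub (hiprod.const_mul _)).add (Scoring.integrable_of_bounded π hg2m hg2b)
  have hint := integral_mono hiL hiU fun x => (hlow x).trans (le_of_eq (hup x))
  -- evaluate both sides
  have hL : ∫ x, ε.toReal * (∫ y, g y ^ 2 ∂ν - 2 * (g x * ∫ y, g y ∂ν) + g x ^ 2) ∂π
      = ε.toReal * (∫ y, g y ^ 2 ∂ν + ∫ x, g x ^ 2 ∂π) := by
    have hi1 : Integrable (fun x => 2 * (g x * ∫ y, g y ∂ν)) π :=
      ((Scoring.integrable_of_bounded π hg hCg).mul_const _).const_mul _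
    have hi2 : Integrable (fun x => (∫ y, g y ^ 2 ∂ν) - 2 * (g x * ∫ y, g y ∂ν)) π :=
      (integrable_const _).sub hi1
    rw [integral_const_mul, integral_add hi2 (Scoring.integrable_of_bounded π hg2m hg2b),
      integral_sub (integrable_const _) hi1, integral_const, probReal_univ, one_smul,
      integral_const_mul, integral_mul_const, hg0, zero_mul, mul_zero, sub_zero]
  have hR : ∫ x, (Scoring.kop P (fun y => g y ^ 2) x - 2 * (g x * Scoring.kop P g x) + g x ^ 2) ∂π
      = 2 * ∫ x, g x ^ 2 ∂π - 2 * ∫ x, g x * Scoring.kop P g x ∂π := by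
    have hi2 : Integrable (fun x => Scoring.kop P (fun y => g y ^ 2) x
        - 2 * (g x * Scoring.kop P g x)) π := hiK2.sub (hiprod.const_mul _)
    have hi3 : Integrable (fun x => 2 * (g x * Scoring.kop P g x)) π := hiprod.const_mul _
    rw [integral_add hi2 (Scoring.integrable_of_bounded π hg2m hg2b), integral_sub hiK2 hi3,
      integral_const_mul, Scoring.integral_kop P hπ hg2m hg2b]
    ring
  rw [hL, hR] at hint
  have hν0 : 0 ≤ ∫ y, g y ^ 2 ∂ν := integral_nonneg fun y => sq_nonneg _
  have he0 : 0 ≤ ε.toReal := ENNReal.toReal_nonneg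
  nlinarith [hint, mul_nonneg he0 hν0]

end Poincare

/-! ## §2 Powers of a minorised kernel; autocovariances through `nHit` -/

section Powers

variable {κ : Kernel S S} [IsMarkovKernel κ] {π : Measure S} [IsProbabilityMeasure π]
  {ν : Measure S} [IsProbabilityMeasure ν] {ε : ℝ≥0∞} {m : ℕ}

omit [IsProbabilityMeasure π] [IsProbabilityMeasure ν] in
/-- Higher powers inherit the minorisation: `ε • ν ≤ (nHit κ (m + k))(z, ·)`. -/
theorem minorised_nHit_add (hmin : ∀ z, ε • ν ≤ nHit κ m z) (k : ℕ) (z : S) :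
    ε • ν ≤ nHit κ (m + k) z := by
  haveI := isMarkovKernel_nHit κ k
  rw [nHit_add, Kernel.comp_apply]
  refine Measure.le_iff.2 fun B hB => ?_
  rw [Measure.bind_apply hB (Kernel.aemeasurable _), Measure.smul_apply, smul_eq_mul]
  calc ε * ν B = ∫⁻ _, ε * ν B ∂(nHit κ k z) := by rw [lintegral_const, measure_univ, mul_one]
    _ ≤ ∫⁻ y, nHit κ m y B ∂(nHit κ k z) := lintegral_mono fun y => by
        have := Measure.le_iff'.1 (hmin y) B
        rwa [Measure.smul_apply, smul_eq_mul] at this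

omit [IsProbabilityMeasure π] [IsProbabilityMeasure ν] in
/-- Minorisation of any power `n ≥ m`. -/
theorem minorised_nHit_of_le (hmin : ∀ z, ε • ν ≤ nHit κ m z) {n : ℕ} (hn : m ≤ n) (z : S) :
    ε • ν ≤ nHit κ n z := by
  obtain ⟨k, rfl⟩ := Nat.exists_eq_add_of_le hn
  exact minorised_nHit_add hmin k z

omit [IsProbabilityMeasure π] in
/-- Autocovariances through the `t`-step kernel: `C(t) = ∫ g · kop (nHit κ t) g dπ`. -/
theorem autocov_eq_integral_mul_kop_nHit {g : S → ℝ} (hg : Measurable g) {Cg : ℝ}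
    (hCg : ∀ x, |g x| ≤ Cg) (t : ℕ) :
    Scoring.autocov κ π g t = ∫ x, g x * Scoring.kop (nHit κ t) g x ∂π := by
  unfold Scoring.autocov
  rw [Scoring.kop_nHit κ t hg hCg]

end Powers

/-! ## §3 Cauchy–Schwarz doubling for a reversible kernel -/

section Doubling

variable {κ : Kernel S S} [IsMarkovKernel κ] {π : Measure S} [IsProbabilityMeasure π]

/-- **`C(n)² ≤ C(0) C(2n)`** for a `π`-reversible kernel and a bounded measurable `g`
(`C(n) = ⟨g, κⁿg⟩ ≤ ‖g‖ ‖κⁿ g‖` and `‖κⁿ g‖² = C(2n)`). -/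
theorem autocov_sq_le_of_isReversible (hrev : Kernel.IsReversible κ π) {g : S → ℝ}
    (hg : Measurable g) {B : ℝ} (hB : ∀ x, |g x| ≤ B) (n : ℕ) :
    Scoring.autocov κ π g n ^ 2 ≤ Scoring.autocov κ π g 0 * Scoring.autocov κ π g (2 * n) := by
  haveI : Nonempty S := nonempty_of_isProbabilityMeasure π
  have hB0 : 0 ≤ B := (abs_nonneg _).trans (hB (Classical.choice ‹Nonempty S›))
  obtain ⟨hKm, hKb⟩ := Scoring.iterate_kop_bounded_measurable κ hg hB n
  have hf2 : Integrable (fun x => g x ^ 2) π :=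
    Scoring.integrable_of_bounded π (hg.pow_const 2) (C := B ^ 2) fun x => by
      rw [abs_pow]; exact pow_le_pow_left₀ (abs_nonneg _) (hB x) 2
  have hG2 : Integrable (fun x => (Scoring.kop κ)^[n] g x ^ 2) π :=
    Scoring.integrable_of_bounded π (hKm.pow_const 2) (C := B ^ 2) fun x => by
      rw [abs_pow]; exact pow_le_pow_left₀ (abs_nonneg _) (hKb x) 2
  have hfG : Integrable (fun x => g x * (Scoring.kop κ)^[n] g x) π :=
    Scoring.integrable_of_bounded π (hg.mul hKm) (C := B * B) fun x => by
      rw [abs_mul]; exact mul_le_mul (hB x) (hKb x) (abs_nonneg _) hB0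
  have hcs := sq_integral_mul_le hf2 hG2 hfG
  -- `∫ (κⁿ g)² dπ = C(2n)` by symmetry
  have htwo := op_two_time (μ := π) (w := fun _ : S => (1 : ℝ)) (K := Scoring.kop κ)
    Scoring.kop_opBdd (Scoring.kop_opSymm hrev) hg hB n n
  rw [Scoring.integral_mul_iterate_kop_mul_one, ← two_mul] at htwo
  have hG2' : ∫ x, (Scoring.kop κ)^[n] g x ^ 2 ∂π = Scoring.autocov κ π g (2 * n) := by
    rw [← htwo]
    exact integral_congr_ae (ae_of_all _ fun x => by simp only [mul_one, sq])
  have h0 : ∫ x, g x ^ 2 ∂π = Scoring.autocov κ π g 0 := (Scoring.autocov_zero κ π g).symm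
  rw [hG2', h0] at hcs
  exact hcs

/-- **Doubling**: `C(2)^{2^J} · C(0) ≤ C(0)^{2^J} · C(2^{J+1})` for every `J`. -/
theorem autocov_two_pow_le_of_isReversible (hrev : Kernel.IsReversible κ π) {g : S → ℝ}
    (hg : Measurable g) {B : ℝ} (hB : ∀ x, |g x| ≤ B) :
    ∀ J : ℕ, Scoring.autocov κ π g 2 ^ (2 ^ J) * Scoring.autocov κ π g 0
      ≤ Scoring.autocov κ π g 0 ^ (2 ^ J) * Scoring.autocov κ π g (2 ^ (J + 1))
  | 0 => by
    rw [pow_zero, pow_one, pow_one, zero_add, pow_one, mul_comm]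
  | J + 1 => by
    have ih := autocov_two_pow_le_of_isReversible hrev hg hB J
    have h2 : 0 ≤ Scoring.autocov κ π g 2 := by
      have := Scoring.autocov_even_nonneg_of_isReversible hrev hg hB 1
      simpa using this
    have h0 : 0 ≤ Scoring.autocov κ π g 0 := by
      rw [Scoring.autocov_zero]; exact integral_nonneg fun x => sq_nonneg _
    have hcs := autocov_sq_le_of_isReversible hrev hg hB (2 ^ (J + 1))
    rw [show 2 * 2 ^ (J + 1) = 2 ^ (J + 1 + 1) by ring] at hcs
    rcases h0.eq_or_lt with hz | hpos
    · rw [← hz, mul_zero, zero_pow (pow_ne_zero _ two_ne_zero), zero_mul]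
    · have hX : 0 ≤ Scoring.autocov κ π g 2 ^ (2 ^ J) * Scoring.autocov κ π g 0 :=
        mul_nonneg (pow_nonneg h2 _) h0
      have hsq := pow_le_pow_left₀ hX ih 2
      have key : Scoring.autocov κ π g 2 ^ (2 ^ (J + 1)) * Scoring.autocov κ π g 0
            * Scoring.autocov κ π g 0
          ≤ Scoring.autocov κ π g 0 ^ (2 ^ (J + 1)) * Scoring.autocov κ π g (2 ^ (J + 1 + 1))
            * Scoring.autocov κ π g 0 :=
        calc Scoring.autocov κ π g 2 ^ (2 ^ (J + 1)) * Scoring.autocov κ π g 0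
              * Scoring.autocov κ π g 0
            = (Scoring.autocov κ π g 2 ^ (2 ^ J) * Scoring.autocov κ π g 0) ^ 2 := by ring
          _ ≤ (Scoring.autocov κ π g 0 ^ (2 ^ J) * Scoring.autocov κ π g (2 ^ (J + 1))) ^ 2 := hsq
          _ = Scoring.autocov κ π g 0 ^ (2 ^ (J + 1)) * Scoring.autocov κ π g (2 ^ (J + 1)) ^ 2 := by
              ring
          _ ≤ Scoring.autocov κ π g 0 ^ (2 ^ (J + 1))
              * (Scoring.autocov κ π g 0 * Scoring.autocov κ π g (2 ^ (J + 1 + 1))) :=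
              mul_le_mul_of_nonneg_left hcs (pow_nonneg h0 _)
          _ = Scoring.autocov κ π g 0 ^ (2 ^ (J + 1)) * Scoring.autocov κ π g (2 ^ (J + 1 + 1))
              * Scoring.autocov κ π g 0 := by ring
      exact le_of_mul_le_mul_right key hpos

end Doubling

/-! ## §4 The lag-one bound and the `τ_int` floor -/

section Floor

variable {κ : Kernel S S} [IsMarkovKernel κ] {π : Measure S} [IsProbabilityMeasure π]
  {ν : Measure S} [IsProbabilityMeasure ν] {ε : ℝ≥0∞} {m : ℕ}

/-- **THE LAG-ONE AUTOCOVARIANCE OF EVERY BOUNDED OBSERVABLE IS BOUNDED AWAY FROM `−C(0)`** for a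
reversible kernel with a Doeblin power: if `ε • ν ≤ (nHit κ m)(z, ·)`, `m ≤ 2^{J+1}`, `0 < r` and
`1 − ε.toReal/2 ≤ r^{2^{J+1}}`, then for `g` bounded measurable centred with `C(0) > 0`:
`C(2) ≤ r² C(0)` and `|C(1)| ≤ r C(0)`. -/
theorem autocov_one_abs_le_of_isReversible_of_nHit (hrev : Kernel.IsReversible κ π)
    (hmin : ∀ z, ε • ν ≤ nHit κ m z) {J : ℕ} (hJ : m ≤ 2 ^ (J + 1)) {r : ℝ} (hr0 : 0 < r)
    (hr : 1 - ε.toReal / 2 ≤ r ^ (2 ^ (J + 1)))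
    {g : S → ℝ} (hg : Measurable g) {B : ℝ} (hB : ∀ x, |g x| ≤ B) (hg0 : ∫ x, g x ∂π = 0)
    (h0pos : 0 < Scoring.autocov κ π g 0) :
    Scoring.autocov κ π g 2 ≤ r ^ 2 * Scoring.autocov κ π g 0
      ∧ |Scoring.autocov κ π g 1| ≤ r * Scoring.autocov κ π g 0 := by
  have hπ : Kernel.Invariant κ π := hrev.invariant
  have h0 : 0 ≤ Scoring.autocov κ π g 0 := h0pos.le
  have h2 : 0 ≤ Scoring.autocov κ π g 2 := by
    have := Scoring.autocov_even_nonneg_of_isReversible hrev hg hB 1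
    simpa using this
  -- Poincaré for `P = nHit κ (2^(J+1))`
  haveI := isMarkovKernel_nHit κ (2 ^ (J + 1))
  have hminN : ∀ z, ε • ν ≤ nHit κ (2 ^ (J + 1)) z := fun z => minorised_nHit_of_le hmin hJ z
  have hP := integral_mul_kop_le_of_minorised (invariant_nHit hπ (2 ^ (J + 1))) hminN hg hB hg0
  rw [← autocov_eq_integral_mul_kop_nHit hg hB (2 ^ (J + 1)), ← Scoring.autocov_zero κ π g] at hP
  -- doubling, then cancel `C(0) > 0` and take the `2^J`-th root
  have hD := autocov_two_pow_le_of_isReversible hrev hg hB J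
  have hrN : r ^ (2 ^ (J + 1)) = (r ^ 2) ^ (2 ^ J) := by
    rw [← pow_mul, pow_succ, mul_comm]
  have hchain : Scoring.autocov κ π g 2 ^ (2 ^ J) * Scoring.autocov κ π g 0
      ≤ (r ^ 2 * Scoring.autocov κ π g 0) ^ (2 ^ J) * Scoring.autocov κ π g 0 := by
    calc Scoring.autocov κ π g 2 ^ (2 ^ J) * Scoring.autocov κ π g 0
        ≤ Scoring.autocov κ π g 0 ^ (2 ^ J) * Scoring.autocov κ π g (2 ^ (J + 1)) := hD
      _ ≤ Scoring.autocov κ π g 0 ^ (2 ^ J) * ((1 - ε.toReal / 2) * Scoring.autocov κ π g 0) :=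
          mul_le_mul_of_nonneg_left hP (pow_nonneg h0 _)
      _ ≤ Scoring.autocov κ π g 0 ^ (2 ^ J) * (r ^ (2 ^ (J + 1)) * Scoring.autocov κ π g 0) :=
          mul_le_mul_of_nonneg_left (mul_le_mul_of_nonneg_right hr h0) (pow_nonneg h0 _)
      _ = (r ^ 2 * Scoring.autocov κ π g 0) ^ (2 ^ J) * Scoring.autocov κ π g 0 := by
          rw [hrN, mul_pow]; ring
  have hC2 : Scoring.autocov κ π g 2 ≤ r ^ 2 * Scoring.autocov κ π g 0 :=
    le_of_pow_le_pow_left₀ (pow_ne_zero _ two_ne_zero) (mul_nonneg (sq_nonneg _) h0)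
      (le_of_mul_le_mul_right hchain h0pos)
  refine ⟨hC2, ?_⟩
  -- `C(1)² ≤ C(0) C(2) ≤ (r C(0))²`
  have hcs := autocov_sq_le_of_isReversible hrev hg hB 1
  rw [mul_one] at hcs
  have hsq : Scoring.autocov κ π g 1 ^ 2 ≤ (r * Scoring.autocov κ π g 0) ^ 2 :=
    calc Scoring.autocov κ π g 1 ^ 2 ≤ Scoring.autocov κ π g 0 * Scoring.autocov κ π g 2 := hcs
      _ ≤ Scoring.autocov κ π g 0 * (r ^ 2 * Scoring.autocov κ π g 0) :=
          mul_le_mul_of_nonneg_left hC2 h0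
      _ = (r * Scoring.autocov κ π g 0) ^ 2 := by ring
  exact abs_le_of_sq_le_sq hsq (mul_nonneg hr0.le h0)

/-- **THE `τ_int` FLOOR FOR A REVERSIBLE KERNEL WITH A DOEBLIN POWER.**  `κ` Markov and
`π`-reversible, `ε • ν ≤ (nHit κ m)(z, ·)` for all `z` (`ε ≠ 0`, `0 < m ≤ 2^{J+1}`), `0 < r < 1` with
`1 − ε.toReal/2 ≤ r^{2^{J+1}}`; `f` bounded measurable with `0 < Var_π f`.  Then, with
`ρ(t) = C_f̄(t)/C_f̄(0)`: `−r ≤ ρ(1)` and `(1 − r)/(2(1 + r)) ≤ Scoring.tauInt ρ`. -/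
theorem tauInt_ge_of_isReversible_of_nHit (hrev : Kernel.IsReversible κ π) (hε : ε ≠ 0)
    (hmin : ∀ z, ε • ν ≤ nHit κ m z) (hm : 0 < m) {J : ℕ} (hJ : m ≤ 2 ^ (J + 1)) {r : ℝ}
    (hr0 : 0 < r) (hr1 : r < 1) (hr : 1 - ε.toReal / 2 ≤ r ^ (2 ^ (J + 1)))
    {f : S → ℝ} (hf : Measurable f) {C : ℝ} (hC : ∀ x, |f x| ≤ C)
    (hvar : 0 < ∫ x, (f x - ∫ z, f z ∂π) ^ 2 ∂π) :
    -r ≤ Scoring.autocov κ π (fun y => f y - ∫ z, f z ∂π) 1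
        / Scoring.autocov κ π (fun y => f y - ∫ z, f z ∂π) 0
      ∧ (1 - r) / (2 * (1 + r))
        ≤ Scoring.tauInt (fun t => Scoring.autocov κ π (fun y => f y - ∫ z, f z ∂π) t
            / Scoring.autocov κ π (fun y => f y - ∫ z, f z ∂π) 0) := by
  haveI : Nonempty S := nonempty_of_isProbabilityMeasure π
  have hπ : Kernel.Invariant κ π := hrev.invariant
  have hε1 : ε ≤ 1 := by
    haveI := isMarkovKernel_nHit κ m
    exact eps_le_one_of_minorised hmin
  have hε0 : 0 < ε := pos_iff_ne_zero.2 hε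
  have hminS : ∀ x {B : Set S}, MeasurableSet B → ε * ν B ≤ nHit κ m x B :=
    fun z B hB => minorised_setwise hmin z hB
  obtain ⟨hfb, hCfb, hfb0⟩ := Scoring.centred_observable_bounds π hf hC
  have h0eq := Scoring.autocov_zero κ π (fun y => f y - ∫ z, f z ∂π)
  have h0pos : 0 < Scoring.autocov κ π (fun y => f y - ∫ z, f z ∂π) 0 := by rw [h0eq]; exact hvar
  obtain ⟨-, h1⟩ := autocov_one_abs_le_of_isReversible_of_nHit hrev hmin hJ hr0 hr hfb hCfb hfb0 h0pos
  -- the lag-one ratio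
  have hρlo : -r ≤ Scoring.autocov κ π (fun y => f y - ∫ z, f z ∂π) 1
      / Scoring.autocov κ π (fun y => f y - ∫ z, f z ∂π) 0 := by
    rw [le_div_iff₀ h0pos]
    have := (abs_le.1 h1).1
    linarith
  have hρhi : Scoring.autocov κ π (fun y => f y - ∫ z, f z ∂π) 1
      / Scoring.autocov κ π (fun y => f y - ∫ z, f z ∂π) 0 ≤ r := by
    rw [div_le_iff₀ h0pos]
    exact (abs_le.1 h1).2
  have hρ1 : Scoring.autocov κ π (fun y => f y - ∫ z, f z ∂π) 1
      / Scoring.autocov κ π (fun y => f y - ∫ z, f z ∂π) 0 < 1 := lt_of_le_of_lt hρhi hr1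
  refine ⟨hρlo, ?_⟩
  -- summability of the tail and Madras–Slade
  have hs : Summable fun t => Scoring.autocov κ π (fun y => f y - ∫ z, f z ∂π) (t + 1)
      / Scoring.autocov κ π (fun y => f y - ∫ z, f z ∂π) 0 :=
    (summable_autocov_centred_succ_of_nHit hminS hε0 hε1 hm hπ hf hC).div_const _
  have hMS := Scoring.tauInt_ge_of_isReversible hrev hfb hCfb hs hρ1
  refine le_trans ?_ hMS
  -- monotonicity of `x ↦ (1 + x)/(2(1 − x))`
  rw [div_le_div_iff₀ (by linarith) (by linarith)]
  nlinarith [hρlo]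

/-- **THE `τ_int` FLOOR FOR EVENTS under a reversible kernel with a Doeblin power**: for every
measurable `A` with `0 < π(A) < 1`, `(1 − r)/(2(1 + r)) ≤ Scoring.tauInt (setACF κ π A)`. -/
theorem tauInt_setACF_ge_of_isReversible_of_nHit (hrev : Kernel.IsReversible κ π) (hε : ε ≠ 0)
    (hmin : ∀ z, ε • ν ≤ nHit κ m z) (hm : 0 < m) {J : ℕ} (hJ : m ≤ 2 ^ (J + 1)) {r : ℝ}
    (hr0 : 0 < r) (hr1 : r < 1) (hr : 1 - ε.toReal / 2 ≤ r ^ (2 ^ (J + 1)))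
    {A : Set S} (hA : MeasurableSet A) (h0 : 0 < π.real A) (h1 : π.real A < 1) :
    (1 - r) / (2 * (1 + r)) ≤ Scoring.tauInt (setACF κ π A) := by
  have hπ : Kernel.Invariant κ π := hrev.invariant
  have hf : Measurable (A.indicator (1 : S → ℝ)) := measurable_one.indicator hA
  have hC : ∀ y, |A.indicator (1 : S → ℝ) y| ≤ 1 := fun y => by
    by_cases hy : y ∈ A <;> simp [hy]
  have hmean : ∫ z, A.indicator (1 : S → ℝ) z ∂π = π.real A := integral_indicator_one hA
  have hvar : 0 < ∫ x, (A.indicator (1 : S → ℝ) x - ∫ z, A.indicator (1 : S → ℝ) z ∂π) ^ 2 ∂π := by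
    rw [hmean, ← Scoring.autocov_zero κ π, autocov_centredIndicator_eq_setAutocov hπ hA 0,
      setAutocov_zero hA]
    exact mul_pos h0 (sub_pos.2 h1)
  have h := (tauInt_ge_of_isReversible_of_nHit hrev hε hmin hm hJ hr0 hr1 hr hf hC hvar).2
  have hfun : (fun t => Scoring.autocov κ π
        (fun y => A.indicator (1 : S → ℝ) y - ∫ z, A.indicator (1 : S → ℝ) z ∂π) t
        / Scoring.autocov κ π
          (fun y => A.indicator (1 : S → ℝ) y - ∫ z, A.indicator (1 : S → ℝ) z ∂π) 0)
      = setACF κ π A := by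
    funext t
    rw [hmean, autocov_centredIndicator_eq_setAutocov hπ hA t,
      autocov_centredIndicator_eq_setAutocov hπ hA 0]
    rfl
  rw [hfun] at h
  exact h

end Floor

end Summit.Ventures.LatticeQCDFlow.Exactness.GeneralNCMC
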